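import Summits.QuantumFields.YangMills.Theorems.FlatTubeReductionDecimationTrivialTerm
import HarnessLib

/-!
# Route `FlatTubeReduction`, crux `PinnedUnitStepEx` (stmt-QuantumFields-27561), stub `stub_smearVarPosGS1` — E2d-2a: reduction of a trivial
# decoder's reading to the base reading

Seat ym-line-fcl-p3 g9 (2026-08-28).  Blueprint v2 §E2 (c): for a link set `R₁` and a decoder `(m̄, v)` which is, direction by direction, EITHER a
merge shift by `m_j` steps through transverse-free slices `1, …, m_j` (`m̄_j = m_j`, `v_j = −m_j`) OR a Polyakov direction (`m̄_j = 0`, `R₁`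
invariant under `e_j`, all links of direction `j`), the pulled-back part through the reading `W_{m̄,v}` equals the base one:
`reading_reduce_dir` (one direction zeroed) and ★ `esPart_reading_eq_base` (`g^{=R₁}(W_{m̄,v} U) = g^{=R₁}(thin L' U)`).
R2b1 RECORD rung; no summit/crux/stub here.
-/

set_option autoImplicit false

noncomputable section

namespace Summit.QuantumFields.YangMills.Theorems.FlatTubeReduction.Decimation

open MeasureTheory Finset Function
open Literature.MathematicalPhysics.QuantumFieldTheory (Site Edge GaugeConfig gaugeTransform haarProbability)
open Literature.MathematicalPhysics.QuantumFieldTheory.TorusTranslation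
open Summit.QuantumFields.YangMills.Theorems.FemtoCutoffLadder.Thinning
open Literature.Probability.Independence.Hoeffding

variable {G : Type*} [Group G] [MeasurableSpace G] [TopologicalSpace G] [IsTopologicalGroup G] [CompactSpace G] [BorelSpace G]
variable {L' : ℕ} [NeZero L']

/-- The per-direction admissibility of a decoder `(m̄, v)` for `R₁` in direction `j`: a merge shift by `m` steps through transverse-free slices, or a
Polyakov direction.  (Stated inline as a disjunction; no new predicate.) ★ **One direction of the reading can be zeroed.** [folklore] -/
theorem reading_reduce_dir (hL : 2 ≤ L') {g : GaugeConfig 3 L' G → ℝ} (hg : Measurable g) {C : ℝ} (hC : ∀ U, |g U| ≤ C)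
    (hGI : ∀ (k : Site 3 L' → G) (W : GaugeConfig 3 L' G), g (gaugeTransform k W) = g W)
    (hTI : ∀ (w : Site 3 L') (U : GaugeConfig 3 L' G), g (torusConfigShift w U) = g U)
    (R₁ : Finset (Edge 3 L')) (j : Fin 3) (mbar : Site 3 L') (v : Site 3 (L' + 1))
    (hj : (∃ m : ℕ, mbar j = (m : ZMod L') ∧ v j = -((m : ℕ) : ZMod (L' + 1)) ∧
            ∀ t : ℕ, t < m → ∀ e ∈ R₁, e.1 j = 1 + (t : ZMod L') → e.2 = j) ∨
          (mbar j = 0 ∧ shiftLinks (Pi.single j (1 : ZMod L') : Site 3 L') R₁ = R₁ ∧ ∀ e ∈ R₁, e.2 = j))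
    (U : GaugeConfig 3 (L' + 1) G) :
    esPart (haarProbability G) R₁ g (fun e : Edge 3 L' => thin L' (torusConfigShift v U) (e.1 - mbar, e.2)) =
      esPart (haarProbability G) R₁ g (fun e : Edge 3 L' =>
        thin L' (torusConfigShift (v - Pi.single j (v j)) U) (e.1 - (mbar - Pi.single j (mbar j)), e.2)) := by
  rcases hj with ⟨m, hm, hv, hslices⟩ | ⟨hm0, hinv, htrans⟩
  · -- merge shift: `m̄ = m̄₀ + m e_j`, `v = v₀ − m e_j` with `m̄₀ = m̄ − m̄_j e_j`, `v₀ = v − v_j e_j`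
    have e1 : mbar = (mbar - Pi.single j (mbar j)) + Pi.single j ((m : ℕ) : ZMod L') := by
      rw [← hm, sub_add_cancel]
    have e2 : v = (v - Pi.single j (v j)) - Pi.single j ((m : ℕ) : ZMod (L' + 1)) := by
      rw [hv, Pi.single_neg, sub_neg_eq_add, add_sub_cancel_right]
    have h := esPart_reading_steps hL hg hGI R₁ j (mbar - Pi.single j (mbar j)) (v - Pi.single j (v j)) m
      (fun t ht e he hej => hslices t ht e he (by
        rw [hej]; simp only [Pi.sub_apply, Pi.single_eq_same, sub_self, zero_add])) U
    rw [← e1, ← e2] at h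
    exact h
  · -- Polyakov direction: `m̄_j = 0`; rotate `v_j` away
    have e1 : mbar - Pi.single j (mbar j) = mbar := by rw [hm0, Pi.single_zero, sub_zero]
    have e2 : v = (v - Pi.single j (v j)) - Pi.single j ((((-(v j)).val : ℕ) : ZMod (L' + 1))) := by
      rw [ZMod.natCast_zmod_val, Pi.single_neg, sub_neg_eq_add, sub_add_cancel]
    have h := esPart_reading_polyakov hL hg hC hGI hTI R₁ j hinv htrans mbar (v - Pi.single j (v j)) ((-(v j)).val) U
    rw [← e2] at h
    rw [e1]
    exact h

/-- ★ **Trivial decoders read like the base decoder**: if `(m̄, v)` is admissible for `R₁` in all three directions then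
`g^{=R₁}(W_{m̄,v} U) = g^{=R₁}(thin L' U)`. [folklore] -/
theorem esPart_reading_eq_base (hL : 2 ≤ L') {g : GaugeConfig 3 L' G → ℝ} (hg : Measurable g) {C : ℝ} (hC : ∀ U, |g U| ≤ C)
    (hGI : ∀ (k : Site 3 L' → G) (W : GaugeConfig 3 L' G), g (gaugeTransform k W) = g W)
    (hTI : ∀ (w : Site 3 L') (U : GaugeConfig 3 L' G), g (torusConfigShift w U) = g U)
    (R₁ : Finset (Edge 3 L')) (mbar : Site 3 L') (v : Site 3 (L' + 1))
    (hadm : ∀ j : Fin 3, (∃ m : ℕ, mbar j = (m : ZMod L') ∧ v j = -((m : ℕ) : ZMod (L' + 1)) ∧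
            ∀ t : ℕ, t < m → ∀ e ∈ R₁, e.1 j = 1 + (t : ZMod L') → e.2 = j) ∨
          (mbar j = 0 ∧ shiftLinks (Pi.single j (1 : ZMod L') : Site 3 L') R₁ = R₁ ∧ ∀ e ∈ R₁, e.2 = j))
    (U : GaugeConfig 3 (L' + 1) G) :
    esPart (haarProbability G) R₁ g (fun e : Edge 3 L' => thin L' (torusConfigShift v U) (e.1 - mbar, e.2)) =
      esPart (haarProbability G) R₁ g (thin L' U) := by
  -- zero the three coordinates one after the other; admissibility of the remaining coordinates is unaffected
  have key : ∀ (n : ℕ) (hn : n ≤ 3) (mbar' : Site 3 L') (v' : Site 3 (L' + 1)),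
      (∀ j : Fin 3, (j : ℕ) < n → mbar' j = 0 ∧ v' j = 0) →
      (∀ j : Fin 3, n ≤ (j : ℕ) → mbar' j = mbar j ∧ v' j = v j) →
      esPart (haarProbability G) R₁ g (fun e : Edge 3 L' => thin L' (torusConfigShift v' U) (e.1 - mbar', e.2)) =
        esPart (haarProbability G) R₁ g (thin L' U) := by
    intro n
    induction' hk : 3 - n with k ih generalizing n
    · intro hn mbar' v' hz _
      have hn3 : n = 3 := by omega
      subst hn3
      have hm : mbar' = 0 := funext fun j => (hz j j.isLt).1
      have hvz : v' = 0 := funext fun j => (hz j j.isLt).2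
      subst hm; subst hvz
      simp only [sub_zero]
      congr 1
      funext e
      rw [Summit.QuantumFields.YangMills.Theorems.FemtoTransferGap.torusConfigShift_zero]
    · intro hn mbar' v' hz hrest
      have hn3 : n < 3 := by omega
      set j : Fin 3 := ⟨n, hn3⟩ with hjdef
      -- admissibility of coordinate `j` for `(mbar', v')` = that of `(mbar, v)`
      have hmj : mbar' j = mbar j := (hrest j (by simp [hjdef])).1
      have hvj : v' j = v j := (hrest j (by simp [hjdef])).2
      have hadm' : (∃ m : ℕ, mbar' j = (m : ZMod L') ∧ v' j = -((m : ℕ) : ZMod (L' + 1)) ∧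
            ∀ t : ℕ, t < m → ∀ e ∈ R₁, e.1 j = 1 + (t : ZMod L') → e.2 = j) ∨
          (mbar' j = 0 ∧ shiftLinks (Pi.single j (1 : ZMod L') : Site 3 L') R₁ = R₁ ∧ ∀ e ∈ R₁, e.2 = j) := by
        rw [hmj, hvj]; exact hadm j
      rw [reading_reduce_dir hL hg hC hGI hTI R₁ j mbar' v' hadm' U]
      refine ih (n + 1) (by omega) (by omega) _ _ (fun j' hj' => ?_) (fun j' hj' => ?_)
      · by_cases hjj : j' = j
        · subst hjj; simp
        · have hlt : (j' : ℕ) < n := by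
            have : (j' : ℕ) ≠ n := fun h => hjj (Fin.ext (by rw [h, hjdef]))
            omega
          obtain ⟨h1, h2⟩ := hz j' hlt
          simp [Pi.sub_apply, hjj, h1, h2]
      · have hjj : j' ≠ j := fun h => by rw [h, hjdef] at hj'; simp at hj'
        obtain ⟨h1, h2⟩ := hrest j' (by omega)
        simp [Pi.sub_apply, hjj, h1, h2]
  exact key 0 (by omega) mbar v (fun j hj => absurd hj (Nat.not_lt_zero _)) (fun j _ => ⟨rfl, rfl⟩)

end Summit.QuantumFields.YangMills.Theorems.FlatTubeReduction.Decimation
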